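import Mathlib
import Literature.Computability.AlgebraicComplexity.OrbitClosure
import Literature.Computability.AlgebraicComplexity.PermanentIrreducible

/-!
# Border apolarity, crux `ToricWitnessObstructionQP` (stmt-ValiantsHypothesis-14753), line `Sketch` —
# REWEIGHTING an extremal toric representation (generic Kőnig weights are free)

Route `ValiantsHypothesis/BorderApolarity`, crux item `stmt-ValiantsHypothesis-14753`, line `Sketch`, lead c1.
The normal form of the line (`stub_normalForm`, landed) writes the padded permanent as the TOP
weighted-homogeneous component `pp = wHC_w^e F` of a translate `F = g · det_m` of the determinant
(`∀ d ∈ supp F, weight_w d ≤ e`), with a weight `w` that is exchange-additive on the per-block.  This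
file records the elementary fact that such a representation can be REWEIGHTED: for every second weight
`κ` for which `pp` is `κ`-weighted-homogeneous (of weight `e₁`) and every `M` exceeding the `κ`-weights
on `supp F`, `pp` is again the top component of `F` for the weight `M • w + κ`, of weight `M e + e₁`
(`weightedHomogeneousComponent_reweight`).  Since the padded permanent is `κ`-weighted-homogeneous for
EVERY exchange-additive (Kőnig) weight `κ(i,j) = α_i + β_j` on the block (each of its monomials uses every
block row and every block column exactly once), the torus leading form of the line may be taken at a
CONTENT-SEPARATING (generic) Kőnig weight at no cost — the entry point of the tight/fooling dichotomy
(card `graded-tight-matrix-dichotomy`: tight ⇒ torus-equivariant affine representation ⇒ `TorusBound`).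
No hypothesis of the crux is used; pure weight bookkeeping over any commutative semiring.
-/

open MvPolynomial Finsupp
open scoped BigOperators

-- the mandated summit-side namespace repeats a component by design (single-problem summit)
set_option linter.dupNamespace false

namespace Summit.ValiantsHypothesis.ValiantsHypothesis.Theorems.BorderApolarityToricWitnessObstructionQP

section Reweight

variable {σ : Type*} {R : Type*} [CommSemiring R]

/-- The weight of an exponent is additive and homogeneous in the weight function:
`weight (M • w + κ) d = M * weight w d + weight κ d`. [folklore] -/
theorem weight_smul_add_apply (M : ℕ) (w κ : σ → ℕ) (d : σ →₀ ℕ) :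
    weight (M • w + κ) d = M * weight w d + weight κ d := by
  simp only [weight_apply, Pi.add_apply, Pi.smul_apply, smul_eq_mul, Finsupp.sum, Finset.mul_sum,
    ← Finset.sum_add_distrib]
  refine Finset.sum_congr rfl fun i _ => ?_
  ring

/-- **Reweighting an extremal weighted component** (registered helper sub-goal of crux
stmt-ValiantsHypothesis-14753, stated in closed `∀` form).  If every exponent of `F` has `w`-weight `≤ e`
(so that `wHC_w^e F` is the TOP `w`-component of `F`) and this top component is `κ`-weighted-homogeneous
of weight `e₁`, then for every `M` with `weight_κ d < M + e₁` on `supp F`, every exponent of `F` has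
`(M • w + κ)`-weight `≤ M e + e₁` and the top `(M • w + κ)`-component of `F` is the same polynomial:
`wHC_{M•w+κ}^{Me+e₁} F = wHC_w^e F`. [folklore] -/
theorem weightedHomogeneousComponent_reweight : ∀ {σ : Type*} {R : Type*} [CommSemiring R]
    (w κ : σ → ℕ) (F : MvPolynomial σ R) (e e₁ M : ℕ),
    (∀ d ∈ F.support, Finsupp.weight w d ≤ e) →
    MvPolynomial.IsWeightedHomogeneous κ (MvPolynomial.weightedHomogeneousComponent w e F) e₁ →
    (∀ d ∈ F.support, Finsupp.weight κ d < M + e₁) →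
    (∀ d ∈ F.support, Finsupp.weight (M • w + κ) d ≤ M * e + e₁) ∧
      MvPolynomial.weightedHomogeneousComponent (M • w + κ) (M * e + e₁) F =
        MvPolynomial.weightedHomogeneousComponent w e F := by
  intro σ R _ w κ F e e₁ M hext hκ hM
  classical
  -- key dichotomy on the support of `F`
  have hkey : ∀ d ∈ F.support,
      (weight w d = e → weight (M • w + κ) d = M * e + e₁) ∧
      (weight w d ≠ e → weight (M • w + κ) d < M * e + e₁) := by
    intro d hd
    refine ⟨fun hwe => ?_, fun hwne => ?_⟩
    · -- top exponents of `F` are exponents of the top component, hence of `κ`-weight `e₁`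
      have hcoeff : coeff d (weightedHomogeneousComponent w e F) ≠ 0 := by
        rw [coeff_weightedHomogeneousComponent, if_pos hwe]
        exact MvPolynomial.mem_support_iff.mp hd
      have hκd : weight κ d = e₁ := hκ hcoeff
      rw [weight_smul_add_apply, hwe, hκd]
    · have hlt : weight w d < e := lt_of_le_of_ne (hext d hd) hwne
      have hle : weight w d + 1 ≤ e := hlt
      have hMd := hM d hd
      rw [weight_smul_add_apply]
      have h1 : M * weight w d + M ≤ M * e := by
        calc M * weight w d + M = M * (weight w d + 1) := by ring
          _ ≤ M * e := Nat.mul_le_mul_left M hle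
      omega
  refine ⟨fun d hd => ?_, ?_⟩
  · by_cases hwe : weight w d = e
    · exact ((hkey d hd).1 hwe).le
    · exact ((hkey d hd).2 hwe).le
  · ext d
    rw [coeff_weightedHomogeneousComponent, coeff_weightedHomogeneousComponent]
    by_cases hd : d ∈ F.support
    · by_cases hwe : weight w d = e
      · rw [if_pos ((hkey d hd).1 hwe), if_pos hwe]
      · rw [if_neg ((hkey d hd).2 hwe).ne, if_neg hwe]
    · rw [MvPolynomial.notMem_support_iff.mp hd]
      simp

/-- The `M` of `weightedHomogeneousComponent_reweight` exists: any `M` exceeding the (finitely many)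
`κ`-weights on the support of `F` works, e.g. `M = 1 + Σ_{d ∈ supp F} weight κ d`. [folklore] -/
theorem exists_reweight (w κ : σ → ℕ) (F : MvPolynomial σ R) (e e₁ : ℕ)
    (hext : ∀ d ∈ F.support, weight w d ≤ e)
    (hκ : IsWeightedHomogeneous κ (weightedHomogeneousComponent w e F) e₁) :
    ∃ M : ℕ, (∀ d ∈ F.support, weight (M • w + κ) d ≤ M * e + e₁) ∧
      weightedHomogeneousComponent (M • w + κ) (M * e + e₁) F = weightedHomogeneousComponent w e F := by
  classical
  refine ⟨1 + ∑ d ∈ F.support, weight κ d, ?_⟩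
  refine weightedHomogeneousComponent_reweight w κ F e e₁ _ hext hκ fun d hd => ?_
  have hle : weight κ d ≤ ∑ d' ∈ F.support, weight κ d' :=
    Finset.single_le_sum (f := fun d' => weight κ d') (fun _ _ => Nat.zero_le _) hd
  omega

end Reweight

section Konig

/-- For an EXCHANGE-ADDITIVE ("Kőnig") weight `κ (i,j) + κ (k,l) = κ (i,l) + κ (k,j)` (equivalently
`κ (i,j) = α_i + β_j`), the weight `Σ_i κ (i, τ i)` of a PERMUTATION pattern does not depend on the
permutation `τ`: it equals the weight of the diagonal pattern.  (This is why the padded permanent is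
`κ`-weighted-homogeneous for every Kőnig weight on its block, the hypothesis `hκ` of
`weightedHomogeneousComponent_reweight`.) [folklore] -/
theorem weight_perm_pattern_eq {n : ℕ} (κ : Fin n × Fin n → ℕ)
    (hκ : ∀ i j k l : Fin n, κ (i, j) + κ (k, l) = κ (i, l) + κ (k, j)) (τ : Equiv.Perm (Fin n)) :
    ∑ i : Fin n, κ (i, τ i) = ∑ i : Fin n, κ (i, i) := by
  -- induction on permutations via swaps: composing with a transposition preserves the sum
  induction τ using Equiv.Perm.swap_induction_on with
  | one => simp
  | swap_mul f x y hxy ih =>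
    rw [← ih]
    -- Σ κ(i, (swap x y * f) i) = Σ κ(i, f i): only the preimages of x and y under ... differ
    -- rewrite both sums through the bijection `i ↦ f⁻¹ i`
    have key : ∀ g : Equiv.Perm (Fin n), ∑ i : Fin n, κ (i, g i) = ∑ j : Fin n, κ (g.symm j, j) := by
      intro g
      exact Fintype.sum_equiv g _ _ fun i => by simp
    rw [key, key f]
    -- now compare Σ_j κ((swap x y * f)⁻¹ j, j) with Σ_j κ(f⁻¹ j, j)
    have hinv : ∀ j, (Equiv.swap x y * f).symm j = f.symm (Equiv.swap x y j) := by
      intro j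
      simp [Equiv.Perm.mul_def, Equiv.symm_swap]
    simp_rw [hinv]
    -- split off the two indices `x` and `y`
    rw [← Finset.sum_erase_add _ _ (Finset.mem_univ x),
      ← Finset.sum_erase_add _ _ (Finset.mem_erase.mpr ⟨hxy.symm, Finset.mem_univ y⟩)]
    conv_rhs => rw [← Finset.sum_erase_add _ _ (Finset.mem_univ x),
      ← Finset.sum_erase_add _ _ (Finset.mem_erase.mpr ⟨hxy.symm, Finset.mem_univ y⟩)]
    have hrest : ∀ j ∈ (Finset.univ.erase x).erase y,
        κ (f.symm (Equiv.swap x y j), j) = κ (f.symm j, j) := by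
      intro j hj
      have hjy : j ≠ y := (Finset.mem_erase.mp hj).1
      have hjx : j ≠ x := (Finset.mem_erase.mp (Finset.mem_erase.mp hj).2).1
      rw [Equiv.swap_apply_of_ne_of_ne hjx hjy]
    rw [Finset.sum_congr rfl hrest, Equiv.swap_apply_left, Equiv.swap_apply_right]
    have hex := hκ (f.symm y) y (f.symm x) x
    -- κ(f⁻¹y, x) + κ(f⁻¹x, y) = κ(f⁻¹y, y) + κ(f⁻¹x, x)
    have hex' : κ (f.symm x, y) + κ (f.symm y, x) = κ (f.symm y, y) + κ (f.symm x, x) := by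
      have := hκ (f.symm x) y (f.symm y) x
      omega
    omega

end Konig

section PaddedPermanent

open Literature.Computability.AlgebraicComplexity

/-- General-index form of `weight_perm_pattern_eq`, with the pattern written `(ρ i, i)` as in the
tree's `permMonomial ρ = Σ_i e_{(ρ i, i)}`: for an exchange-additive weight the weight of a permutation
pattern is that of the diagonal pattern. [folklore] -/
theorem sum_weight_perm_eq_sum_diag {ι : Type*} [Fintype ι] [DecidableEq ι] (κ : ι × ι → ℕ)
    (hκ : ∀ i j k l : ι, κ (i, j) + κ (k, l) = κ (i, l) + κ (k, j)) (ρ : Equiv.Perm ι) :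
    ∑ i : ι, κ (ρ i, i) = ∑ i : ι, κ (i, i) := by
  induction ρ using Equiv.Perm.swap_induction_on with
  | one => simp
  | swap_mul f x y hxy ih =>
    rw [← ih]
    simp only [Equiv.Perm.mul_apply]
    -- reindex both sides by `j = f i`
    have key : ∑ i : ι, κ (Equiv.swap x y (f i), i) = ∑ j : ι, κ (Equiv.swap x y j, f.symm j) :=
      Fintype.sum_equiv f _ _ fun i => by simp
    have key1 : ∑ i : ι, κ (f i, i) = ∑ j : ι, κ (j, f.symm j) :=
      Fintype.sum_equiv f _ _ fun i => by simp
    rw [key, key1]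
    rw [← Finset.sum_erase_add _ _ (Finset.mem_univ x),
      ← Finset.sum_erase_add _ _ (Finset.mem_erase.mpr ⟨hxy.symm, Finset.mem_univ y⟩)]
    conv_rhs => rw [← Finset.sum_erase_add _ _ (Finset.mem_univ x),
      ← Finset.sum_erase_add _ _ (Finset.mem_erase.mpr ⟨hxy.symm, Finset.mem_univ y⟩)]
    have hrest : ∀ j ∈ (Finset.univ.erase x).erase y,
        κ (Equiv.swap x y j, f.symm j) = κ (j, f.symm j) := by
      intro j hj
      have hjy : j ≠ y := (Finset.mem_erase.mp hj).1
      have hjx : j ≠ x := (Finset.mem_erase.mp (Finset.mem_erase.mp hj).2).1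
      rw [Equiv.swap_apply_of_ne_of_ne hjx hjy]
    rw [Finset.sum_congr rfl hrest, Equiv.swap_apply_left, Equiv.swap_apply_right]
    have hex := hκ x (f.symm y) y (f.symm x)
    omega

/-- The weight of a permutation monomial `μ_ρ` under an exchange-additive weight is the weight of the
diagonal monomial, `Σ_i κ (i, i)`. [folklore] -/
theorem weight_permMonomial_eq {ι : Type*} [Fintype ι] [DecidableEq ι] (κ : ι × ι → ℕ)
    (hκ : ∀ i j k l : ι, κ (i, j) + κ (k, l) = κ (i, l) + κ (k, j)) (ρ : Equiv.Perm ι) :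
    weight κ (permMonomial ρ) = ∑ i : ι, κ (i, i) := by
  rw [permMonomial, map_sum]
  simp only [weight_single, smul_eq_mul, one_mul]
  exact sum_weight_perm_eq_sum_diag κ hκ ρ

/-- **The permanent is weighted homogeneous for every exchange-additive ("Kőnig") weight**, of weight
`Σ_i κ (i, i)`: each of its monomials takes every row and every column exactly once. [folklore] -/
theorem perPoly_isWeightedHomogeneous_of_exchange {ι : Type*} [Fintype ι] [DecidableEq ι]
    (R : Type*) [CommSemiring R] (κ : ι × ι → ℕ)
    (hκ : ∀ i j k l : ι, κ (i, j) + κ (k, l) = κ (i, l) + κ (k, j)) :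
    IsWeightedHomogeneous κ (perPoly ι R) (∑ i : ι, κ (i, i)) := by
  rw [perPoly_eq_sum_monomial R]
  refine IsWeightedHomogeneous.sum _ _ _ fun ρ _ => ?_
  exact isWeightedHomogeneous_monomial κ _ _ (weight_permMonomial_eq κ hκ ρ)

/-- Transport of weighted homogeneity along an injective renaming: if `φ` is `κ ∘ f`-weighted
homogeneous of weight `e`, then `rename f φ` is `κ`-weighted homogeneous of weight `e`. [folklore] -/
theorem isWeightedHomogeneous_rename_of_injective {σ τ : Type*} {R : Type*} [CommSemiring R]
    {f : σ → τ} (hf : Function.Injective f) (κ : τ → ℕ) {φ : MvPolynomial σ R} {e : ℕ}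
    (hφ : IsWeightedHomogeneous (κ ∘ f) φ e) : IsWeightedHomogeneous κ (rename f φ) e := by
  classical
  intro d hd
  -- a coefficient of `rename f φ` at `d` is nonzero only if `d = mapDomain f d'` with `coeff d' φ ≠ 0`
  obtain ⟨d', rfl⟩ : ∃ d' : σ →₀ ℕ, Finsupp.mapDomain f d' = d := by
    by_contra hne
    push Not at hne
    apply hd
    exact coeff_rename_eq_zero f φ d fun u hu => (hne u hu).elim
  rw [coeff_rename_mapDomain f hf] at hd
  have hw := hφ hd
  -- weights agree: `weight κ (mapDomain f d') = weight (κ ∘ f) d'`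
  rw [← hw]
  simp only [weight_apply, Finsupp.sum]
  rw [Finsupp.mapDomain_support_of_injective hf, Finset.sum_image (hf.injOn)]
  refine Finset.sum_congr rfl fun i _ => ?_
  rw [Finsupp.mapDomain_apply hf]
  rfl

/-- **The padded permanent is weighted homogeneous for every weight that is exchange-additive on the
per-block**, of weight `(m - n) · κ (0,0) + Σ_{i in the block} κ (i, i)` — the hypothesis `hκ` of
`weightedHomogeneousComponent_reweight` / `exists_reweight` for `pp`.  Hence the torus leading form of an
extremal toric representation of `pp` (normal form of line `Sketch`) can be REWEIGHTED by any Kőnig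
weight on the block, e.g. a content-separating one. [folklore] -/
theorem paddedPerPoly_isWeightedHomogeneous_of_exchange (n m : ℕ) [NeZero m]
    (κ : Fin m × Fin m → ℕ)
    (hκ : ∀ i j k l : Fin m, m - n ≤ (i : ℕ) → m - n ≤ (k : ℕ) → m - n ≤ (j : ℕ) → m - n ≤ (l : ℕ) →
      κ (i, j) + κ (k, l) = κ (i, l) + κ (k, j)) :
    IsWeightedHomogeneous κ (paddedPerPoly ℂ n m)
      ((m - n) * κ (0, 0) + ∑ i : BlockIdx n m, κ ((i : Fin m), (i : Fin m))) := by
  classical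
  unfold paddedPerPoly
  have hX : IsWeightedHomogeneous κ ((X (0, 0) : MvPolynomial (Fin m × Fin m) ℂ) ^ (m - n))
      ((m - n) • κ (0, 0)) := (isWeightedHomogeneous_X ℂ κ (0, 0)).pow (m - n)
  rw [smul_eq_mul] at hX
  refine hX.mul ?_
  set emb : BlockIdx n m × BlockIdx n m → Fin m × Fin m :=
    fun ij => ((ij.1 : Fin m), (ij.2 : Fin m)) with hemb
  have hinj : Function.Injective emb := by
    intro a b hab
    simp only [hemb, Prod.mk.injEq] at hab
    exact Prod.ext (Subtype.ext hab.1) (Subtype.ext hab.2)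
  refine isWeightedHomogeneous_rename_of_injective hinj κ ?_
  have hκ' : ∀ i j k l : BlockIdx n m,
      (κ ∘ emb) (i, j) + (κ ∘ emb) (k, l) = (κ ∘ emb) (i, l) + (κ ∘ emb) (k, j) :=
    fun i j k l => hκ i j k l i.2 k.2 j.2 l.2
  exact perPoly_isWeightedHomogeneous_of_exchange ℂ (κ ∘ emb) hκ'

/-- **Reweighting the normal form of line `Sketch` by a Kőnig weight.**  If `pp = wHC_w^e F` with all
`w`-weights of `F` at most `e` (an extremal toric representation of the padded permanent, e.g. the output
of `stub_normalForm`), then for every weight `κ` that is exchange-additive on the per-block there is `M`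
with `pp = wHC_{M•w+κ}^{Me+e₁} F`, all `(M•w+κ)`-weights of `F` at most `M e + e₁`, where
`e₁ = (m-n) κ₀₀ + Σ_block κ (i,i)`; if `w` is exchange-additive on the block, so is `M • w + κ`. [folklore] -/
theorem extremalRep_reweight_konig (n m : ℕ) [NeZero m] (w κ : Fin m × Fin m → ℕ)
    (F : MvPolynomial (Fin m × Fin m) ℂ) (e : ℕ)
    (hext : ∀ d ∈ F.support, weight w d ≤ e)
    (hpp : paddedPerPoly ℂ n m = weightedHomogeneousComponent w e F)
    (hκ : ∀ i j k l : Fin m, m - n ≤ (i : ℕ) → m - n ≤ (k : ℕ) → m - n ≤ (j : ℕ) → m - n ≤ (l : ℕ) →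
      κ (i, j) + κ (k, l) = κ (i, l) + κ (k, j)) :
    ∃ M : ℕ,
      (∀ d ∈ F.support, weight (M • w + κ) d ≤
        M * e + ((m - n) * κ (0, 0) + ∑ i : BlockIdx n m, κ ((i : Fin m), (i : Fin m)))) ∧
      paddedPerPoly ℂ n m = weightedHomogeneousComponent (M • w + κ)
        (M * e + ((m - n) * κ (0, 0) + ∑ i : BlockIdx n m, κ ((i : Fin m), (i : Fin m)))) F ∧
      ((∀ i j k l : Fin m, m - n ≤ (i : ℕ) → m - n ≤ (k : ℕ) → m - n ≤ (j : ℕ) → m - n ≤ (l : ℕ) →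
          w (i, j) + w (k, l) = w (i, l) + w (k, j)) →
        ∀ i j k l : Fin m, m - n ≤ (i : ℕ) → m - n ≤ (k : ℕ) → m - n ≤ (j : ℕ) → m - n ≤ (l : ℕ) →
          (M • w + κ) (i, j) + (M • w + κ) (k, l) = (M • w + κ) (i, l) + (M • w + κ) (k, j)) := by
  have hhom : IsWeightedHomogeneous κ (weightedHomogeneousComponent w e F)
      ((m - n) * κ (0, 0) + ∑ i : BlockIdx n m, κ ((i : Fin m), (i : Fin m))) := by
    rw [← hpp]
    exact paddedPerPoly_isWeightedHomogeneous_of_exchange n m κ hκ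
  obtain ⟨M, hM, hcomp⟩ := exists_reweight w κ F e _ hext hhom
  refine ⟨M, hM, ?_, ?_⟩
  · rw [hcomp, hpp]
  · intro hw i j k l hi hk hj hl
    simp only [Pi.add_apply, Pi.smul_apply, smul_eq_mul]
    have h1 := hw i j k l hi hk hj hl
    have h2 := hκ i j k l hi hk hj hl
    nlinarith [h1, h2]

end PaddedPermanent

end Summit.ValiantsHypothesis.ValiantsHypothesis.Theorems.BorderApolarityToricWitnessObstructionQP
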